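import Mathlib
import Summits.ValiantsHypothesis.ValiantsHypothesis.Theorems.ProofCarryingSymmetryRestorationQPESatDefs
import Summits.ValiantsHypothesis.ValiantsHypothesis.Theorems.ProofCarryingSymmetryRestorationQPESatEMul
import Summits.ValiantsHypothesis.ValiantsHypothesis.Theorems.ProofCarryingSymmetryRestorationQPESatHom

/-!
# Route ProofCarryingSymmetry — crux `RestorationQP`, line `registered`: the e-saturation depends on the
instance only through the classes of its pieces

Support file for the crux item `stmt-ValiantsHypothesis-10343` (lead c5, rung S3^(1)-inv, stub
`esat_acEq_of_pieces`).  The e-saturation `ACStability.esat d` of `…ESatDefs.lean` (smart sums,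
peeled smart products) reads the ground distributivity instance `d = (P, Q, R)` only through the
constant-normal forms `p, q, r` of its pieces, and those only modulo AC: replacing `P`, `Q`, `R` by
formulas congruent modulo the distributivity-free fragment `UCEq` changes every value `esat d F`
only up to AC-equivalence (for a generic instance).  Steps:

* `UCEq`-congruent pieces have AC-equivalent normal forms `p, q, r` (`acEq_cnorm_of_ucEq`), hence
  AC-equivalent `s` and expansion `sig` (`sadd_congr`, `smul_congr`), EQUAL root constant `cP` and
  EQUAL pattern `pat` (normal forms modulo AC are (root factor classes, root constant):
  `NF.mset_eq_of_acEq`), and genericity transports (`ACEq.nvars_eq`);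
* hence peeling with respect to `d` and to `d'` agrees up to AC on normal forms
  (`epeel_acEq_epeel`: equal `kmax`, equal peeled factor classes and root constant,
  `NF.acEq_of_mset_eq`), and so does the peeled smart product (`emul_acEq_emul`);
* induction on the formula, carrying normality of the values (`nf_esat`), gives `esat_acEq_esat` and
  the registered statement `esat_acEq_of_pieces`.

Everything here is elementary and proved; no named facts.
-/

-- single-problem summit: `Summit.ValiantsHypothesis.ValiantsHypothesis.…` is the namespace by design (D-0017)
set_option linter.dupNamespace false

noncomputable section

open scoped Classical

namespace Summit.ValiantsHypothesis.ValiantsHypothesis.Theorems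

namespace ACStability

open Literature.Computability.AlgebraicComplexity ACClass

universe u v

variable {𝔽 : Type u} [Field 𝔽] {X : Type v}

/-! ### Instances with congruent pieces -/

namespace DistData

variable {d d' : DistData 𝔽 X}

/-- Instances with `UCEq`-congruent `P` have AC-equivalent normal forms `p`. [folklore] -/
theorem acEq_p_of_ucEq (hP : UCEq d.P d'.P) : ACEq d.p d'.p := acEq_cnorm_of_ucEq hP

/-- Instances with `UCEq`-congruent `Q` have AC-equivalent normal forms `q`. [folklore] -/
theorem acEq_q_of_ucEq (hQ : UCEq d.Q d'.Q) : ACEq d.q d'.q := acEq_cnorm_of_ucEq hQ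

/-- Instances with `UCEq`-congruent `R` have AC-equivalent normal forms `r`. [folklore] -/
theorem acEq_r_of_ucEq (hR : UCEq d.R d'.R) : ACEq d.r d'.r := acEq_cnorm_of_ucEq hR

/-- Instances with `UCEq`-congruent `Q`, `R` have AC-equivalent `s = cnorm (Q + R)`. [folklore] -/
theorem acEq_s_of_ucEq (hQ : UCEq d.Q d'.Q) (hR : UCEq d.R d'.R) : ACEq d.s d'.s :=
  sadd_congr d.nf_q d'.nf_q d.nf_r d'.nf_r (acEq_q_of_ucEq hQ) (acEq_r_of_ucEq hR)

/-- Instances with `UCEq`-congruent pieces have AC-equivalent expansions `sig`. [folklore] -/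
theorem acEq_sig_of_ucEq (hP : UCEq d.P d'.P) (hQ : UCEq d.Q d'.Q) (hR : UCEq d.R d'.R) :
    ACEq d.sig d'.sig :=
  sadd_congr (nf_smul d.nf_p d.nf_q) (nf_smul d'.nf_p d'.nf_q) (nf_smul d.nf_p d.nf_r)
    (nf_smul d'.nf_p d'.nf_r)
    (smul_congr d.nf_p d'.nf_p d.nf_q d'.nf_q (acEq_p_of_ucEq hP) (acEq_q_of_ucEq hQ))
    (smul_congr d.nf_p d'.nf_p d.nf_r d'.nf_r (acEq_p_of_ucEq hP) (acEq_r_of_ucEq hR))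

/-- Instances with `UCEq`-congruent `P` have the same root constant `cP`. [folklore] -/
theorem cP_eq_of_ucEq (hP : UCEq d.P d'.P) : d.cP = d'.cP :=
  (d.nf_p.mset_eq_of_acEq d'.nf_p (acEq_p_of_ucEq hP)).2

/-- The pattern is the root factor classes of `p` plus the class of `s`. [folklore] -/
theorem pat_eq_mset_p_add (d : DistData 𝔽 X) : d.pat = mset d.p + {ACClass.mk d.s} := by
  rw [DistData.pat, DistData.patF, List.map_append, ← Multiset.coe_add, mset_def]
  rfl

/-- **Instances with `UCEq`-congruent pieces have the same pattern.** [folklore] -/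
theorem pat_eq_of_ucEq (hP : UCEq d.P d'.P) (hQ : UCEq d.Q d'.Q) (hR : UCEq d.R d'.R) :
    d.pat = d'.pat := by
  rw [pat_eq_mset_p_add d, pat_eq_mset_p_add d',
    (d.nf_p.mset_eq_of_acEq d'.nf_p (acEq_p_of_ucEq hP)).1, mk_eq_mk.2 (acEq_s_of_ucEq hQ hR)]

/-- Genericity transports along `UCEq`-congruent pieces. [folklore] -/
theorem Generic.of_ucEq (hg : d.Generic) (hP : UCEq d.P d'.P) (hQ : UCEq d.Q d'.Q)
    (hR : UCEq d.R d'.R) : d'.Generic := by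
  obtain ⟨h1, h2, h3⟩ := hg
  rw [(acEq_p_of_ucEq hP).nvars_eq] at h1
  rw [(acEq_q_of_ucEq hQ).nvars_eq] at h2
  rw [(acEq_r_of_ucEq hR).nvars_eq] at h3
  exact ⟨h1, h2, h3⟩

end DistData

/-! ### Cross-instance peeling -/

/-- **Peeling depends on the (generic) instance only through `pat`, `cP` and the class of `sig`.**
[folklore] -/
theorem epeel_acEq_epeel {d d' : DistData 𝔽 X} (hg : d.Generic) (hg' : d'.Generic)
    (hpat : d.pat = d'.pat) (hcP : d.cP = d'.cP) (hsig : ACEq d.sig d'.sig) {x : PIFormula 𝔽 X}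
    (hx : NF x) : ACEq (epeel d x) (epeel d' x) := by
  by_cases hk : kmax (mset x) d.pat = 0
  · have hk' : kmax (mset x) d'.pat = 0 := by rwa [← hpat]
    rw [epeel_of_kmax_eq_zero d hk, epeel_of_kmax_eq_zero d' hk']
    exact .refl _
  · have hk' : kmax (mset x) d'.pat ≠ 0 := by rwa [← hpat]
    refine (nf_epeel hg hx).acEq_of_mset_eq (nf_epeel hg' hx) ?_ ?_
    · rw [mset_epeel hg hx, mset_epeel hg' hx, hpat, mk_eq_mk.2 hsig]
    · rw [mcst_epeel hg hx hk, mcst_epeel hg' hx hk', hpat, hcP]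

/-- **The peeled smart product of normal forms depends on the (generic) instance only through
`pat`, `cP` and the class of `sig`.** [folklore] -/
theorem emul_acEq_emul {d d' : DistData 𝔽 X} (hg : d.Generic) (hg' : d'.Generic)
    (hpat : d.pat = d'.pat) (hcP : d.cP = d'.cP) (hsig : ACEq d.sig d'.sig) {a b : PIFormula 𝔽 X}
    (ha : NF a) (hb : NF b) : ACEq (emul d a b) (emul d' a b) :=
  epeel_acEq_epeel hg hg' hpat hcP hsig (nf_smul ha hb)

/-- **The e-saturation depends on the (generic) instance only through `pat`, `cP` and the class of
`sig`**, up to AC. [folklore] -/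
theorem esat_acEq_esat {d d' : DistData 𝔽 X} (hg : d.Generic) (hg' : d'.Generic)
    (hpat : d.pat = d'.pat) (hcP : d.cP = d'.cP) (hsig : ACEq d.sig d'.sig) (F : PIFormula 𝔽 X) :
    ACEq (esat d F) (esat d' F) := by
  induction F with
  | var x => exact .refl _
  | const c => exact .refl _
  | add F G ihF ihG =>
    rw [esat_add, esat_add]
    exact sadd_congr (nf_esat hg F) (nf_esat hg' F) (nf_esat hg G) (nf_esat hg' G) ihF ihG
  | mul F G ihF ihG =>
    rw [esat_mul, esat_mul]
    exact (emul_congr hg (nf_esat hg F) (nf_esat hg' F) (nf_esat hg G) (nf_esat hg' G) ihF ihG).trans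
      (emul_acEq_emul hg hg' hpat hcP hsig (nf_esat hg' F) (nf_esat hg' G))

/-- **The e-saturation depends on the (generic) instance only through the `UCEq`-classes of its
pieces**, up to AC. [folklore] -/
theorem esat_acEq_of_ucEq_pieces {d d' : DistData 𝔽 X} (hg : d.Generic) (hP : UCEq d.P d'.P)
    (hQ : UCEq d.Q d'.Q) (hR : UCEq d.R d'.R) (F : PIFormula 𝔽 X) :
    ACEq (esat d F) (esat d' F) :=
  esat_acEq_esat hg (hg.of_ucEq hP hQ hR) (DistData.pat_eq_of_ucEq hP hQ hR)
    (DistData.cP_eq_of_ucEq hP) (DistData.acEq_sig_of_ucEq hP hQ hR) F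

end ACStability

open Literature.Computability.AlgebraicComplexity in
/-- **The e-saturation depends on the instance only through the classes of its pieces**
(registered helper of crux `RestorationQP`, line `registered`, rung S3^(1)-inv): for a generic
ground distributivity instance `d = (P, Q, R)`, replacing `P`, `Q`, `R` by formulas congruent
modulo the distributivity-free fragment `UCEq` changes the e-saturated normal form of every formula
only up to AC. [folklore] -/
theorem esat_acEq_of_pieces : ∀ {𝔽 : Type} [Field 𝔽] {X : Type} (d d' : ACStability.DistData 𝔽 X), d.Generic → ACStability.UCEq d.P d'.P → ACStability.UCEq d.Q d'.Q → ACStability.UCEq d.R d'.R → ∀ F : PIFormula 𝔽 X, ACStability.ACEq (ACStability.esat d F) (ACStability.esat d' F) :=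
  fun _ _ hg hP hQ hR F => ACStability.esat_acEq_of_ucEq_pieces hg hP hQ hR F

end Summit.ValiantsHypothesis.ValiantsHypothesis.Theorems

end
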